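import Summits.BirchSwinnertonDyer.BirchSwinnertonDyer.Theorems.ResidualThetaTransportAtTwoThetaLayerLambdaCongruenceAtTwoCuspSpanCharacterOdd
import HarnessLib

/-!
# Route `ResidualThetaTransportAtTwo`, cruxes Kan⁺ (stmt-BirchSwinnertonDyer-20688) / node 27436 / 21437: the ROW `B_m = {b = −m}`
# of `Γ₀(N)` carries a MULTIPLICATIVE character of `d mod mN` (every odd `m`, every odd `N`)

Cell `bsd-wall`, width seat `bsd-wall-rtt-p3-w4` g2 (2026-08-28), lane «3-fold B₁-products at prime-power and composite level»,
memo `Cruxes/ThetaLayerLambdaCongruenceAtTwo/Lines/birth-rows-allodd.md` §2 (Claim A). THEOREMS ONLY;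
`--supports stmt-BirchSwinnertonDyer-20688`; BSD is not proved by this.

THE DEVICE. `D := diag(m, 1)`; `γ' ↦ D γ' D⁻¹ = (a', m b'; c'/m, d')` maps `Γ₀(mN) → Γ₀(N)` multiplicatively, preserving the trace and
the lower-right entry. Hence for `χ : Γ₀(N) → 𝔽₂` additive, killing the small-trace elements and the `|d| = 4^k` elements,
`χ ∘ Ad(D)` is ADMISSIBLE at the odd level `mN`, and `…CuspSpanCharacterOdd` (p638351) applies to it: its `B₁`-character is
multiplicative on `(ℤ/mN)ˣ`. Since `D (α, −1; mNκ, δ) D⁻¹ = (α, −m; Nκ, δ)`, this says: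
* `chi_eq_of_b_neg_of_cast_eq` — on the row `B_m(N)` the value of `χ` depends only on `d mod mN`;
* `chi_add_chi_add_chi_eq_zero_row` — for `γ₁, γ₂, γ₃ ∈ B_m(N)` with `d₃ ≡ d₁ d₂ (mod mN)`: `χ γ₁ + χ γ₂ + χ γ₃ = 0`;
* `chi_eq_of_b_neg_of_mul_cast_eq_neg_one` — `d d' ≡ −1 (mod mN)` ⟹ `χ γ = χ γ'`; `exists_b_neg_of_isUnit` — every unit residue
  mod `mN` is the `d` of an element of `B_m(N)`; `chi_eq_zero_of_b_neg_of_cast_eq_one` — `d ≡ 1 (mod mN)` ⟹ `χ γ = 0` (`T^{−m}`).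
Sequel: `…CuspSpanRowInduction` (all odd rows are killed ⟹ (G‴)_N ⟹ the node at every odd `N`).

References: [Rademacher1929] §1; [Knapp1993] Prop. 11.1; [Pollack2003] Conj. 6.3.
-/

set_option autoImplicit false
set_option linter.dupNamespace false

noncomputable section

open scoped MatrixGroups

open CongruenceSubgroup

namespace Summit.BirchSwinnertonDyer.BirchSwinnertonDyer.Theorems.SignedMuAtTwo.Rows

variable {N : ℕ} {χ : Gamma0 N → ZMod 2}

/-! ## §1. The conjugation `Γ₀(mN) → Γ₀(N)` -/

/-- **`D γ' D⁻¹ ∈ Γ₀(N)` for `γ' ∈ Γ₀(mN)`**, `D = diag(m, 1)`: the element of `Γ₀(N)` with entries `(a', m b'; c'/m, d')`.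
[folklore] -/
theorem exists_conj [NeZero N] (m : ℕ) (γ' : Gamma0 (m * N)) :
    ∃ γ : Gamma0 N, (γ : SL(2, ℤ)) 0 0 = (γ' : SL(2, ℤ)) 0 0 ∧ (γ : SL(2, ℤ)) 0 1 = m * (γ' : SL(2, ℤ)) 0 1 ∧
      (m : ℤ) * (γ : SL(2, ℤ)) 1 0 = (γ' : SL(2, ℤ)) 1 0 ∧ (γ : SL(2, ℤ)) 1 1 = (γ' : SL(2, ℤ)) 1 1 := by
  obtain ⟨c, hc⟩ : ((m * N : ℕ) : ℤ) ∣ (γ' : SL(2, ℤ)) 1 0 := by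
    have h := γ'.2; rw [Gamma0_mem] at h
    exact (ZMod.intCast_zmod_eq_zero_iff_dvd _ (m * N)).mp h
  have hdet := Matrix.SpecialLinearGroup.det_coe (γ' : SL(2, ℤ))
  rw [Matrix.det_fin_two] at hdet
  obtain ⟨γ, h00, h01, h10, h11⟩ := ThetaLayerLambdaCongruenceAtTwo.exists_gamma0_entries (N := N)
    ((γ' : SL(2, ℤ)) 0 0) (m * (γ' : SL(2, ℤ)) 0 1) (N * c) ((γ' : SL(2, ℤ)) 1 1)
    (by rw [hc] at hdet; push_cast at hdet; linear_combination hdet) (dvd_mul_right _ _)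
  refine ⟨γ, h00, h01, ?_, h11⟩
  rw [h10, hc]; push_cast; ring

/-- Uniqueness: an element of `Γ₀(N)` is determined by the entry data of a conjugate. [folklore] -/
theorem conj_unique (m : ℕ) (hm : m ≠ 0) {γ₁ γ₂ : Gamma0 N} {γ' : Gamma0 (m * N)}
    (h1 : (γ₁ : SL(2, ℤ)) 0 0 = (γ' : SL(2, ℤ)) 0 0 ∧ (γ₁ : SL(2, ℤ)) 0 1 = m * (γ' : SL(2, ℤ)) 0 1 ∧
      (m : ℤ) * (γ₁ : SL(2, ℤ)) 1 0 = (γ' : SL(2, ℤ)) 1 0 ∧ (γ₁ : SL(2, ℤ)) 1 1 = (γ' : SL(2, ℤ)) 1 1)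
    (h2 : (γ₂ : SL(2, ℤ)) 0 0 = (γ' : SL(2, ℤ)) 0 0 ∧ (γ₂ : SL(2, ℤ)) 0 1 = m * (γ' : SL(2, ℤ)) 0 1 ∧
      (m : ℤ) * (γ₂ : SL(2, ℤ)) 1 0 = (γ' : SL(2, ℤ)) 1 0 ∧ (γ₂ : SL(2, ℤ)) 1 1 = (γ' : SL(2, ℤ)) 1 1) : γ₁ = γ₂ := by
  have hm' : (m : ℤ) ≠ 0 := by exact_mod_cast hm
  refine ThetaLayerLambdaCongruenceAtTwo.gamma0_ext (by rw [h1.1, h2.1]) (by rw [h1.2.1, h2.2.1]) ?_ (by rw [h1.2.2.2, h2.2.2.2])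
  exact mul_left_cancel₀ hm' (by rw [h1.2.2.1, h2.2.2.1])

/-- **The transported character is admissible and the relation descends.** For odd `m` and odd `N`, `χ` additive on `Γ₀(N)`
killing the small-trace and the `|d| = 4^k` elements: for `γ₁, γ₂, γ₃ ∈ Γ₀(N)` with `b = −m` and `d₃ ≡ d₁ d₂ (mod mN)`,
`χ γ₁ + χ γ₂ + χ γ₃ = 0`; and `χ` on the row `b = −m` depends only on `d mod mN`. [cite: Pollack2003, Conj. 6.3] -/
theorem chi_add_chi_add_chi_eq_zero_row_and (hN : Odd N) (m : ℕ) (hm : Odd m)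
    (hadd : ∀ γ δ : Gamma0 N, χ (γ * δ) = χ γ + χ δ)
    (hsmall : ∀ γ : Gamma0 N, ((γ : SL(2, ℤ)) 0 0 + (γ : SL(2, ℤ)) 1 1).natAbs ≤ 2 → χ γ = 0)
    (hkill : ∀ γ : Gamma0 N, (∃ k : ℕ, 1 ≤ k ∧ ((γ : SL(2, ℤ)) 1 1).natAbs = 4 ^ k) → χ γ = 0) :
    (∀ {γ₁ γ₂ γ₃ : Gamma0 N}, (γ₁ : SL(2, ℤ)) 0 1 = -(m : ℤ) → (γ₂ : SL(2, ℤ)) 0 1 = -(m : ℤ) → (γ₃ : SL(2, ℤ)) 0 1 = -(m : ℤ) →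
      ((((γ₃ : SL(2, ℤ)) 1 1 : ℤ) : ZMod (m * N))) =
        ((((γ₁ : SL(2, ℤ)) 1 1 : ℤ) : ZMod (m * N))) * ((((γ₂ : SL(2, ℤ)) 1 1 : ℤ) : ZMod (m * N))) →
      χ γ₁ + χ γ₂ + χ γ₃ = 0) ∧
    (∀ {γ γ' : Gamma0 N}, (γ : SL(2, ℤ)) 0 1 = -(m : ℤ) → (γ' : SL(2, ℤ)) 0 1 = -(m : ℤ) →
      ((((γ : SL(2, ℤ)) 1 1 : ℤ) : ZMod (m * N))) = ((((γ' : SL(2, ℤ)) 1 1 : ℤ) : ZMod (m * N))) → χ γ = χ γ') ∧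
    (∀ {γ γ' : Gamma0 N}, (γ : SL(2, ℤ)) 0 1 = -(m : ℤ) → (γ' : SL(2, ℤ)) 0 1 = -(m : ℤ) →
      ((((γ : SL(2, ℤ)) 1 1 : ℤ) : ZMod (m * N))) * ((((γ' : SL(2, ℤ)) 1 1 : ℤ) : ZMod (m * N))) = -1 → χ γ = χ γ') := by
  classical
  haveI : NeZero N := ⟨hN.pos.ne'⟩
  have hm0 : m ≠ 0 := hm.pos.ne'
  haveI : NeZero (m * N) := ⟨Nat.mul_ne_zero hm0 (NeZero.ne N)⟩
  have hmN : Odd (m * N) := hm.mul hN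
  -- the transported character
  let χm : Gamma0 (m * N) → ZMod 2 := fun γ' ↦ χ (Classical.choose (exists_conj m γ'))
  have hconj : ∀ γ' : Gamma0 (m * N), ∀ γ : Gamma0 N,
      ((γ : SL(2, ℤ)) 0 0 = (γ' : SL(2, ℤ)) 0 0 ∧ (γ : SL(2, ℤ)) 0 1 = m * (γ' : SL(2, ℤ)) 0 1 ∧
        (m : ℤ) * (γ : SL(2, ℤ)) 1 0 = (γ' : SL(2, ℤ)) 1 0 ∧ (γ : SL(2, ℤ)) 1 1 = (γ' : SL(2, ℤ)) 1 1) → χm γ' = χ γ := by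
    intro γ' γ h
    simp only [χm]
    rw [conj_unique m hm0 (Classical.choose_spec (exists_conj m γ')) h]
  have hadd' : ∀ γ' δ' : Gamma0 (m * N), χm (γ' * δ') = χm γ' + χm δ' := by
    intro γ' δ'
    obtain ⟨hγ1, hγ2, hγ3, hγ4⟩ := Classical.choose_spec (exists_conj m γ')
    obtain ⟨hδ1, hδ2, hδ3, hδ4⟩ := Classical.choose_spec (exists_conj m δ')
    set g := Classical.choose (exists_conj m γ')
    set d := Classical.choose (exists_conj m δ')
    have hprod : χm (γ' * δ') = χ (g * d) := by
      apply hconj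
      refine ⟨?_, ?_, ?_, ?_⟩
      · rw [gamma0_mul_apply_zero_zero', gamma0_mul_apply_zero_zero', hγ1, hγ2, hδ1, ← hδ3]; ring
      · rw [gamma0_mul_apply_zero_one, gamma0_mul_apply_zero_one, hγ1, hγ2, hδ2, hδ4]; ring
      · rw [ThetaLayerLambdaCongruenceAtTwo.gamma0_mul_apply_one_zero, ThetaLayerLambdaCongruenceAtTwo.gamma0_mul_apply_one_zero,
          ← hγ3, hγ4, hδ1, ← hδ3]; ring
      · rw [gamma0_mul_apply_one_one', gamma0_mul_apply_one_one', hγ4, hδ2, hδ4, ← hγ3]; ring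
    rw [hprod, hadd]
  have hsmall' : ∀ γ' : Gamma0 (m * N), ((γ' : SL(2, ℤ)) 0 0 + (γ' : SL(2, ℤ)) 1 1).natAbs ≤ 2 → χm γ' = 0 := by
    intro γ' ht
    obtain ⟨h1, -, -, h4⟩ := Classical.choose_spec (exists_conj m γ')
    exact hsmall _ (by rw [h1, h4]; exact ht)
  have hkill' : ∀ γ' : Gamma0 (m * N), (∃ k : ℕ, 1 ≤ k ∧ ((γ' : SL(2, ℤ)) 1 1).natAbs = 4 ^ k) → χm γ' = 0 := by
    rintro γ' ⟨k, hk, hd⟩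
    obtain ⟨-, -, -, h4⟩ := Classical.choose_spec (exists_conj m γ')
    exact hkill _ ⟨k, hk, by rw [h4, hd]⟩
  -- from `B_m(N)` to `B₁(mN)`
  have hlift : ∀ γ : Gamma0 N, (γ : SL(2, ℤ)) 0 1 = -(m : ℤ) →
      ∃ γ' : Gamma0 (m * N), (γ' : SL(2, ℤ)) 0 1 = -1 ∧ (γ' : SL(2, ℤ)) 1 1 = (γ : SL(2, ℤ)) 1 1 ∧ χm γ' = χ γ := by
    intro γ hb
    have hdet := Matrix.SpecialLinearGroup.det_coe (γ : SL(2, ℤ))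
    rw [Matrix.det_fin_two, hb] at hdet
    obtain ⟨c, hc⟩ : (N : ℤ) ∣ (γ : SL(2, ℤ)) 1 0 := by
      have h := γ.2; rw [Gamma0_mem] at h
      exact (ZMod.intCast_zmod_eq_zero_iff_dvd _ N).mp h
    obtain ⟨γ', g00, g01, g10, g11⟩ := ThetaLayerLambdaCongruenceAtTwo.exists_gamma0_entries (N := m * N)
      ((γ : SL(2, ℤ)) 0 0) (-1) ((m * N : ℕ) * c) ((γ : SL(2, ℤ)) 1 1)
      (by rw [hc] at hdet; push_cast; linear_combination hdet) (dvd_mul_right _ _)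
    refine ⟨γ', g01, g11, hconj γ' γ ⟨g00.symm, by rw [g01, hb]; ring, by rw [g10, hc]; push_cast; ring, g11.symm⟩⟩
  refine ⟨?_, ?_, ?_⟩
  · intro γ₁ γ₂ γ₃ hb1 hb2 hb3 h3
    obtain ⟨γ'₁, hb'1, hd1, e1⟩ := hlift γ₁ hb1
    obtain ⟨γ'₂, hb'2, hd2, e2⟩ := hlift γ₂ hb2
    obtain ⟨γ'₃, hb'3, hd3, e3⟩ := hlift γ₃ hb3
    rw [← e1, ← e2, ← e3]
    exact chi_add_chi_add_chi_eq_zero_odd hmN hadd' hsmall' hkill' hb'1 hb'2 hb'3 (by rw [hd1, hd2, hd3]; exact h3)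
  · intro γ γ₀ hb hb0 hd
    obtain ⟨γ', hb', hd', e⟩ := hlift γ hb
    obtain ⟨γ'₀, hb'0, hd'0, e0⟩ := hlift γ₀ hb0
    rw [← e, ← e0]
    exact chi_eq_of_apply_zero_one_eq_neg_one hadd' hsmall' hb' hb'0 (by rw [hd', hd'0]; exact hd)
  · intro γ γ₀ hb hb0 hd
    obtain ⟨γ', hb', hd', e⟩ := hlift γ hb
    obtain ⟨γ'₀, hb'0, hd'0, e0⟩ := hlift γ₀ hb0
    rw [← e, ← e0]
    exact chi_eq_of_b_neg_one_of_mul_d_eq_neg_one hadd' hsmall' hb' hb'0 (by rw [hd', hd'0]; exact hd)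

/-- **`χ` on the row `b = −m` is multiplicative in `d mod mN`** (`m`, `N` odd). [cite: Pollack2003, Conj. 6.3] -/
theorem chi_add_chi_add_chi_eq_zero_row (hN : Odd N) (m : ℕ) (hm : Odd m)
    (hadd : ∀ γ δ : Gamma0 N, χ (γ * δ) = χ γ + χ δ)
    (hsmall : ∀ γ : Gamma0 N, ((γ : SL(2, ℤ)) 0 0 + (γ : SL(2, ℤ)) 1 1).natAbs ≤ 2 → χ γ = 0)
    (hkill : ∀ γ : Gamma0 N, (∃ k : ℕ, 1 ≤ k ∧ ((γ : SL(2, ℤ)) 1 1).natAbs = 4 ^ k) → χ γ = 0)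
    {γ₁ γ₂ γ₃ : Gamma0 N} (hb1 : (γ₁ : SL(2, ℤ)) 0 1 = -(m : ℤ)) (hb2 : (γ₂ : SL(2, ℤ)) 0 1 = -(m : ℤ))
    (hb3 : (γ₃ : SL(2, ℤ)) 0 1 = -(m : ℤ))
    (h3 : ((((γ₃ : SL(2, ℤ)) 1 1 : ℤ) : ZMod (m * N))) =
      ((((γ₁ : SL(2, ℤ)) 1 1 : ℤ) : ZMod (m * N))) * ((((γ₂ : SL(2, ℤ)) 1 1 : ℤ) : ZMod (m * N)))) :
    χ γ₁ + χ γ₂ + χ γ₃ = 0 :=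
  (chi_add_chi_add_chi_eq_zero_row_and hN m hm hadd hsmall hkill).1 hb1 hb2 hb3 h3

/-- **`χ` on the row `b = −m` depends only on `d mod mN`.** [folklore] -/
theorem chi_eq_of_b_neg_of_cast_eq (hN : Odd N) (m : ℕ) (hm : Odd m)
    (hadd : ∀ γ δ : Gamma0 N, χ (γ * δ) = χ γ + χ δ)
    (hsmall : ∀ γ : Gamma0 N, ((γ : SL(2, ℤ)) 0 0 + (γ : SL(2, ℤ)) 1 1).natAbs ≤ 2 → χ γ = 0)
    (hkill : ∀ γ : Gamma0 N, (∃ k : ℕ, 1 ≤ k ∧ ((γ : SL(2, ℤ)) 1 1).natAbs = 4 ^ k) → χ γ = 0)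
    {γ γ' : Gamma0 N} (hb : (γ : SL(2, ℤ)) 0 1 = -(m : ℤ)) (hb' : (γ' : SL(2, ℤ)) 0 1 = -(m : ℤ))
    (h : ((((γ : SL(2, ℤ)) 1 1 : ℤ) : ZMod (m * N))) = ((((γ' : SL(2, ℤ)) 1 1 : ℤ) : ZMod (m * N)))) : χ γ = χ γ' :=
  (chi_add_chi_add_chi_eq_zero_row_and hN m hm hadd hsmall hkill).2.1 hb hb' h

/-- **`d d' ≡ −1 (mod mN)` ⟹ `χ γ = χ γ'` on the row `b = −m`.** [folklore] -/
theorem chi_eq_of_b_neg_of_mul_cast_eq_neg_one (hN : Odd N) (m : ℕ) (hm : Odd m)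
    (hadd : ∀ γ δ : Gamma0 N, χ (γ * δ) = χ γ + χ δ)
    (hsmall : ∀ γ : Gamma0 N, ((γ : SL(2, ℤ)) 0 0 + (γ : SL(2, ℤ)) 1 1).natAbs ≤ 2 → χ γ = 0)
    (hkill : ∀ γ : Gamma0 N, (∃ k : ℕ, 1 ≤ k ∧ ((γ : SL(2, ℤ)) 1 1).natAbs = 4 ^ k) → χ γ = 0)
    {γ γ' : Gamma0 N} (hb : (γ : SL(2, ℤ)) 0 1 = -(m : ℤ)) (hb' : (γ' : SL(2, ℤ)) 0 1 = -(m : ℤ))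
    (h : ((((γ : SL(2, ℤ)) 1 1 : ℤ) : ZMod (m * N))) * ((((γ' : SL(2, ℤ)) 1 1 : ℤ) : ZMod (m * N))) = -1) :
    χ γ = χ γ' :=
  (chi_add_chi_add_chi_eq_zero_row_and hN m hm hadd hsmall hkill).2.2 hb hb' h

/-! ## §2. Supply: elements of the row with prescribed `d mod mN`; the element with `d = 1` -/

/-- **Every unit residue mod `mN` is the `d` of an element of `Γ₀(N)` with `b = −m`.** [folklore] -/
theorem exists_b_neg_of_isUnit [NeZero N] (m : ℕ) (hm : m ≠ 0) {r : ZMod (m * N)} (hr : IsUnit r) :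
    ∃ γ : Gamma0 N, (γ : SL(2, ℤ)) 0 1 = -(m : ℤ) ∧ ((((γ : SL(2, ℤ)) 1 1 : ℤ) : ZMod (m * N))) = r := by
  haveI : NeZero (m * N) := ⟨Nat.mul_ne_zero hm (NeZero.ne N)⟩
  obtain ⟨β', hb', hd'⟩ := exists_b_neg_one_of_isUnit (N := m * N) hr
  obtain ⟨γ, h00, h01, h10, h11⟩ := exists_conj m β'
  exact ⟨γ, by rw [h01, hb']; ring, by rw [h11]; exact hd'⟩

/-- **`d ≡ 1 (mod mN)` on the row `b = −m` ⟹ `χ γ = 0`** (`χ`-equivalent to `T^{−m}`). [folklore] -/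
theorem chi_eq_zero_of_b_neg_of_cast_eq_one (hN : Odd N) (m : ℕ) (hm : Odd m)
    (hadd : ∀ γ δ : Gamma0 N, χ (γ * δ) = χ γ + χ δ)
    (hsmall : ∀ γ : Gamma0 N, ((γ : SL(2, ℤ)) 0 0 + (γ : SL(2, ℤ)) 1 1).natAbs ≤ 2 → χ γ = 0)
    (hkill : ∀ γ : Gamma0 N, (∃ k : ℕ, 1 ≤ k ∧ ((γ : SL(2, ℤ)) 1 1).natAbs = 4 ^ k) → χ γ = 0)
    {γ : Gamma0 N} (hb : (γ : SL(2, ℤ)) 0 1 = -(m : ℤ)) (h : ((((γ : SL(2, ℤ)) 1 1 : ℤ) : ZMod (m * N))) = 1) : χ γ = 0 := by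
  haveI : NeZero N := ⟨hN.pos.ne'⟩
  obtain ⟨T, hT00, hT01, -, hT11⟩ :=
    ThetaLayerLambdaCongruenceAtTwo.exists_gamma0_entries (N := N) 1 (-(m : ℤ)) 0 1 (by ring) (dvd_zero _)
  rw [chi_eq_of_b_neg_of_cast_eq hN m hm hadd hsmall hkill hb hT01 (by rw [h, hT11]; push_cast; rfl)]
  exact hsmall T (by rw [hT00, hT11]; decide)

end Summit.BirchSwinnertonDyer.BirchSwinnertonDyer.Theorems.SignedMuAtTwo.Rows

end
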